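import Mathlib
import HarnessLib
import Literature.Analysis.FluidPDE.ClassicalSolution
import Literature.Analysis.FluidPDE.ClassicalSolutionCalculus
import Literature.Analysis.FluidPDE.LocalTypeI
import Literature.Analysis.FluidPDE.SpaceTimeRescaling
import Summits.NavierStokesRegularity.NavierStokesRegularity.Theorems.TypeICertificateLadderNoTypeIBlowupTypeIMorrey
import Summits.NavierStokesRegularity.NavierStokesRegularity.Theorems.TypeICertificateLadderNoTypeIBlowupMorrey
import Summits.NavierStokesRegularity.NavierStokesRegularity.Theorems.TerminalTraceTypeITraceScarL3TopSingularNull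
import Summits.NavierStokesRegularity.NavierStokesRegularity.Theorems.TypeIQuarterGateScarEnvelopeTypeIBudgetTools

/-!
# Route `TypeIQuarterGate`, crux `FiniteScarsTypeI` (stmt-NavierStokesRegularity-23842) — NEAR-MISS OF
# RECORD: the final-time scar set of a sup-norm Type-I blow-up is `H¹`-null

Helper file (no new definitions) for item 23842 `TypeIQuarterGate.FiniteScarsTypeI` («a sup-norm-rate
Type-I maximal classical Leray–Hopf blow-up has FINITELY many singular points at `T`»; OPEN: the
scale-invariant count is known only under a Lorentz bound, Choe–Wolf–Yang 2018 / Barker 2024).  This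
file proves the statement with «finite» weakened to «of one-dimensional Hausdorff measure zero», in
the item's own currency:

* `hausdorffMeasure_scarSet_eq_zero_of_typeI` — for a classical solution on `[0, T)` (viscosity
  `ν > 0`), Leray–Hopf on `[0, T)`, with the sup-norm Type-I rate at `T`, the SCAR SET
  `{x | ¬ ∃ r > 0, ∃ A, ∀ t ∈ [T − r², T), ∀ y ∈ B(x, r), ‖u t y‖ ≤ A}` has `μH[1] = 0`.

Mechanism (all tree theorems): the Morrey bound of a Type-I solution (`morrey_of_typeI`,
Seregin–Šverák 2009 L.3.5 / Barker–Prange 2020) and the viscosity-normalising zoom about `(T, x₀)`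
(`exists_zoom_typeIBound_lt_top_of_morrey`) put the zoom `v = α u(T + β·, x₀ + R·)` in
Albritton–Barker's ball class on `Q(0, 1)`; CKN's Theorem B AT THE TOP of that ball (Tsai 1998, remark
after Lemma 4.2 — tree `tsai1998_top_singular_null_holds`, packaged as
`TypeITraceScarL3.hausdorffMeasure_topSingular_inBall_eq_zero`) makes the top singular set of `v`
`H¹`-null; a scar `x ∈ B(x₀, R)` of `u` is the image `x₀ + R y` of a top singular point `y` of `v`
(`scar_subset_image_topSingular`: an `L^∞` bound for `v` on `Q_r(0, y)` transports through the affine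
map to an `L^∞` bound for `u` on `Q_{r'}(T, x)` and, `u` being continuous below `T`, to a pointwise
bound); Lipschitz images of `H¹`-null sets are `H¹`-null; and countably many balls `B(x₀, R_{x₀})`
cover the scar set (second countability).  The Type-I rate enters only through the Morrey bound.

HONEST FRAMING: a near-miss, not the item: FINITENESS of the scar set (23842), its sibling 23843, the
parent `QuarterLawTypeI` and the summit are OPEN; nothing here is credited toward them.
-/

noncomputable section

-- the summit-side namespace `Summit.NavierStokesRegularity.NavierStokesRegularity.…` (single-conjunct
-- summit, D-0017) repeats a component by design; the dupNamespace linter would flag every declaration.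
set_option linter.dupNamespace false

namespace Summit.NavierStokesRegularity.NavierStokesRegularity.Theorems.FiniteScarsTypeI

open MeasureTheory Set Function Filter Topology TopologicalSpace Metric
open scoped NNReal ENNReal
open Literature.Analysis Literature.Analysis.FluidPDE

/-- The SCAR SET of `u` at time `T` in the currency of item 23842: the points `x` near which `u` is
NOT bounded on any backward parabolic neighbourhood `[T − r², T) × B(x, r)`. -/
theorem scarSet_def (u : ℝ → EuclideanSpace ℝ (Fin 3) → EuclideanSpace ℝ (Fin 3)) (T : ℝ) :
    {x : EuclideanSpace ℝ (Fin 3) | ¬ ∃ r : ℝ, 0 < r ∧ ∃ A : ℝ,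
        ∀ t ∈ Ico (T - r ^ 2) T, ∀ y ∈ ball x r, ‖u t y‖ ≤ A} =
      {x : EuclideanSpace ℝ (Fin 3) | ∀ r : ℝ, 0 < r → ∀ A : ℝ,
        ∃ t ∈ Ico (T - r ^ 2) T, ∃ y ∈ ball x r, A < ‖u t y‖} := by
  ext x
  simp only [mem_setOf_eq, not_exists, not_and, not_forall, not_le]
  constructor
  · intro h r hr A
    obtain ⟨t, ht, y, hy, hlt⟩ := h r hr A
    exact ⟨t, ht, y, hy, hlt⟩
  · intro h r hr A
    obtain ⟨t, ht, y, hy, hlt⟩ := h r hr A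
    exact ⟨t, ht, y, hy, hlt⟩

/-- **Transport of regularity through the viscosity-normalising zoom.**  Let `u` be continuous on
`[0, T) × ℝ³`, `v = α • u(T + β·, x₀ + R·)` (`α, β, R > 0`).  If `v` is essentially bounded on a backward
cylinder `Q_r(0, y)`, `0 < r`, then `u` is bounded on a backward parabolic
neighbourhood `[T − r'², T) × B(x₀ + R y, r')` of `x₀ + R y`. -/
theorem bounded_of_zoom_bounded {T α β R : ℝ} (hT : 0 < T) (hα : 0 < α) (hβ : 0 < β) (hR : 0 < R)
    {x₀ : EuclideanSpace ℝ (Fin 3)}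
    {u : ℝ → EuclideanSpace ℝ (Fin 3) → EuclideanSpace ℝ (Fin 3)}
    (hcont : ContinuousOn (uncurry u) (Ico 0 T ×ˢ univ))
    {y : EuclideanSpace ℝ (Fin 3)} {r : ℝ} (hr : 0 < r)
    (hbd : eLpNorm (uncurry (α • stPull β R T x₀ u)) ∞
      (volume.restrict (parabolicCylinder r (((0 : ℝ), y) : ℝ × EuclideanSpace ℝ (Fin 3)))) < ⊤) :
    ∃ r' : ℝ, 0 < r' ∧ ∃ A : ℝ, ∀ t ∈ Ico (T - r' ^ 2) T, ∀ z ∈ ball (x₀ + R • y) r', ‖u t z‖ ≤ A := by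
  set v : ℝ → EuclideanSpace ℝ (Fin 3) → EuclideanSpace ℝ (Fin 3) := α • stPull β R T x₀ u with hv
  set Qv : Set (ℝ × EuclideanSpace ℝ (Fin 3)) :=
    parabolicCylinder r (((0 : ℝ), y) : ℝ × EuclideanSpace ℝ (Fin 3)) with hQv
  set x : EuclideanSpace ℝ (Fin 3) := x₀ + R • y with hx
  -- ### the essential bound for `v` on `Q_r(0, y)`, as an a.e. bound for `u ∘ Φ`
  set C : ℝ≥0∞ := eLpNorm (uncurry v) ∞ (volume.restrict Qv) with hC
  have hCtop : C ≠ ⊤ := hbd.ne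
  have hae_v : ∀ᵐ w ∂(volume.restrict Qv), ‖uncurry v w‖ₑ ≤ C := by
    have := enorm_ae_le_eLpNormEssSup (uncurry v) (volume.restrict Qv)
    rwa [← eLpNorm_exponent_top] at this
  have hae_u : ∀ᵐ w ∂(volume.restrict Qv),
      ‖uncurry u (stAffine β R T x₀ w)‖ₑ ≤ (ENNReal.ofReal α)⁻¹ * C := by
    filter_upwards [hae_v] with w hw
    have e : uncurry v w = α • uncurry u (stAffine β R T x₀ w) := by
      obtain ⟨s, z⟩ := w
      rfl
    rw [e, enorm_smul, Real.enorm_eq_ofReal hα.le] at hw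
    have hα0 : ENNReal.ofReal α ≠ 0 := (ENNReal.ofReal_pos.2 hα).ne'
    calc ‖uncurry u (stAffine β R T x₀ w)‖ₑ
        = (ENNReal.ofReal α)⁻¹ * (ENNReal.ofReal α * ‖uncurry u (stAffine β R T x₀ w)‖ₑ) := by
          rw [← mul_assoc, ENNReal.inv_mul_cancel hα0 ENNReal.ofReal_ne_top, one_mul]
      _ ≤ (ENNReal.ofReal α)⁻¹ * C := mul_le_mul' le_rfl hw
  -- ### the inverse affine map `Ψ` and the small cylinder `Q_{r'}(T, x) ⊆ Ψ⁻¹(Q_r(0, y))`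
  set Ψ : ℝ × EuclideanSpace ℝ (Fin 3) → ℝ × EuclideanSpace ℝ (Fin 3) :=
    stAffine β⁻¹ R⁻¹ (-(T / β)) (-(R⁻¹ • x₀)) with hΨ
  have hΦΨ : ∀ w, stAffine β R T x₀ (Ψ w) = w := by
    rintro ⟨t, z⟩
    rw [hΨ, stAffine_apply, stAffine_apply]
    ext1
    · field_simp
      ring
    · rw [smul_add, smul_smul, mul_inv_cancel₀ hR.ne', one_smul, smul_neg, smul_smul,
        mul_inv_cancel₀ hR.ne', one_smul]
      abel_nf
  set m : ℝ := min (Real.sqrt β) R with hm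
  have hm0 : 0 < m := lt_min (Real.sqrt_pos.2 hβ) hR
  have hmβ : m ≤ Real.sqrt β := min_le_left _ _
  have hmR : m ≤ R := min_le_right _ _
  set r' : ℝ := min (r * m) (Real.sqrt T) with hr'
  have hr'0 : 0 < r' := lt_min (mul_pos hr hm0) (Real.sqrt_pos.2 hT)
  have hr'le : r' ≤ r * m := min_le_left _ _
  have hr'T : r' ^ 2 ≤ T := by
    have h1 : r' ≤ Real.sqrt T := min_le_right _ _
    have h2 := pow_le_pow_left₀ hr'0.le h1 2
    rwa [Real.sq_sqrt hT.le] at h2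
  have hsubΨ : parabolicCylinder r' (((T : ℝ), x) : ℝ × EuclideanSpace ℝ (Fin 3)) ⊆ Ψ ⁻¹' Qv := by
    rintro ⟨t, z⟩ hw
    rw [mem_parabolicCylinder] at hw
    simp only at hw
    obtain ⟨⟨h1, h2⟩, h3⟩ := hw
    rw [mem_preimage, hΨ, stAffine_apply, hQv, mem_parabolicCylinder]
    simp only
    refine ⟨⟨?_, ?_⟩, ?_⟩
    · -- time: `-(T/β) + β⁻¹ t > -r²` since `T - t < r'² ≤ r² β`
      have hr'β : r' ^ 2 ≤ r ^ 2 * β := by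
        have h0 : r' ^ 2 ≤ (r * m) ^ 2 := pow_le_pow_left₀ hr'0.le hr'le 2
        rw [mul_pow] at h0
        have : m ^ 2 ≤ β := by
          calc m ^ 2 ≤ Real.sqrt β ^ 2 := pow_le_pow_left₀ hm0.le hmβ 2
            _ = β := Real.sq_sqrt hβ.le
        exact h0.trans (mul_le_mul_of_nonneg_left this (sq_nonneg r))
      have key : -(T / β) + β⁻¹ * t = -((T - t) / β) := by field_simp; ring
      rw [key, zero_sub, neg_lt_neg_iff, div_lt_iff₀ hβ]
      linarith
    · have key : -(T / β) + β⁻¹ * t = -((T - t) / β) := by field_simp; ring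
      rw [key, neg_lt_zero]
      exact div_pos (by linarith) hβ
    · -- space: `dist (−R⁻¹x₀ + R⁻¹ z) y = R⁻¹ dist z x < r'/R ≤ r`
      rw [dist_eq_norm] at h3 ⊢
      have e : -(R⁻¹ • x₀) + R⁻¹ • z - y = R⁻¹ • (z - x) := by
        rw [hx, smul_sub, smul_add, smul_smul, inv_mul_cancel₀ hR.ne', one_smul]
        abel
      rw [e, norm_smul, norm_inv, Real.norm_of_nonneg hR.le]
      calc R⁻¹ * ‖z - x‖ < R⁻¹ * r' := mul_lt_mul_of_pos_left h3 (inv_pos.2 hR)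
        _ ≤ R⁻¹ * (r * R) :=
            mul_le_mul_of_nonneg_left (hr'le.trans (mul_le_mul_of_nonneg_left hmR hr.le))
              (inv_pos.2 hR).le
        _ = r := by field_simp
  -- ### the a.e. bound for `u` on `Q_{r'}(T, x)`
  have hae_u' : ∀ᵐ w ∂(volume.restrict (parabolicCylinder r' (((T : ℝ), x) : ℝ × EuclideanSpace ℝ (Fin 3)))),
      ‖uncurry u w‖ₑ ≤ (ENNReal.ofReal α)⁻¹ * C := by
    have h1 := ae_restrict_preimage_stAffine (inv_pos.2 hβ) (inv_pos.2 hR) (-(T / β)) (-(R⁻¹ • x₀))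
      (S := Qv) (P := fun w => ‖uncurry u (stAffine β R T x₀ w)‖ₑ ≤ (ENNReal.ofReal α)⁻¹ * C) hae_u
    have h2 : ∀ᵐ w ∂(volume.restrict (Ψ ⁻¹' Qv)), ‖uncurry u w‖ₑ ≤ (ENNReal.ofReal α)⁻¹ * C := by
      filter_upwards [h1] with w hw
      rwa [hΦΨ w] at hw
    exact ae_restrict_of_ae_restrict_of_subset hsubΨ h2
  have hess : eLpNorm (uncurry u) ∞
      (volume.restrict (parabolicCylinder r' (((T : ℝ), x) : ℝ × EuclideanSpace ℝ (Fin 3)))) ≤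
        (ENNReal.ofReal α)⁻¹ * C := by
    rw [eLpNorm_exponent_top]
    exact eLpNormEssSup_le_of_ae_enorm_bound hae_u'
  -- ### pointwise bound by continuity below `T` (the cylinder `Q_{r'}(T, x)` lies in `[0,T) × ℝ³`)
  set O : Set (ℝ × EuclideanSpace ℝ (Fin 3)) :=
    parabolicCylinder r' (((T : ℝ), x) : ℝ × EuclideanSpace ℝ (Fin 3)) with hO
  have hOsub : O ⊆ Ico 0 T ×ˢ univ := by
    rintro ⟨t, z⟩ hw
    rw [hO, mem_parabolicCylinder] at hw
    exact ⟨⟨by linarith [hw.1.1], hw.1.2⟩, mem_univ _⟩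
  have hcontO : ContinuousOn (uncurry u) O := hcont.mono hOsub
  have hfin : (ENNReal.ofReal α)⁻¹ * C ≠ ⊤ :=
    ENNReal.mul_ne_top (ENNReal.inv_ne_top.2 (ENNReal.ofReal_pos.2 hα).ne') hCtop
  set r'' : ℝ := r' / 2 with hr''
  have hr''0 : 0 < r'' := by positivity
  refine ⟨r'', hr''0, ((ENNReal.ofReal α)⁻¹ * C).toReal, fun t ht z hz => ?_⟩
  have hmemO : ((t, z) : ℝ × EuclideanSpace ℝ (Fin 3)) ∈ O := by
    rw [hO, mem_parabolicCylinder]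
    simp only
    rw [mem_ball] at hz
    have h4 : r'' ^ 2 < r' ^ 2 := by rw [hr'']; nlinarith
    exact ⟨⟨by linarith [ht.1], ht.2⟩, by linarith⟩
  have h1 : ‖uncurry u (t, z)‖ₑ ≤ (ENNReal.ofReal α)⁻¹ * C :=
    (Summit.NavierStokesRegularity.NavierStokesRegularity.Cruxes.ScarEnvelopeTypeI.SliceBudget.enorm_le_eLpNorm_top_of_continuousOn
      (isOpen_parabolicCylinder _ _) hcontO hmemO).trans hess
  have h2 : ‖u t z‖ₑ ≤ (ENNReal.ofReal α)⁻¹ * C := h1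
  rw [← ofReal_norm] at h2
  exact (ENNReal.ofReal_le_iff_le_toReal hfin).1 h2

/-- **Scars of `u` near `x₀` are images of top singular points of the zoom.**  With `u`, `v` as in
`bounded_of_zoom_bounded`: every scar of `u` (item 23842's sense) in `B(x₀, R)` is `x₀ + R y` for some
backward singular point `(0, y)` of `v` with `y ∈ B(0, 1)`. -/
theorem scar_subset_image_topSingular {T α β R : ℝ} (hT : 0 < T) (hα : 0 < α) (hβ : 0 < β)
    (hR : 0 < R) {x₀ : EuclideanSpace ℝ (Fin 3)}
    {u : ℝ → EuclideanSpace ℝ (Fin 3) → EuclideanSpace ℝ (Fin 3)}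
    (hcont : ContinuousOn (uncurry u) (Ico 0 T ×ˢ univ)) :
    {x ∈ ball x₀ R | ¬ ∃ r : ℝ, 0 < r ∧ ∃ A : ℝ,
        ∀ t ∈ Ico (T - r ^ 2) T, ∀ y ∈ ball x r, ‖u t y‖ ≤ A} ⊆
      (fun y : EuclideanSpace ℝ (Fin 3) => x₀ + R • y) ''
        {y ∈ ball (0 : EuclideanSpace ℝ (Fin 3)) 1 |
          IsBackwardSingularPoint (α • stPull β R T x₀ u) ((0 : ℝ), y)} := by
  rintro x ⟨hx, hscar⟩
  set y : EuclideanSpace ℝ (Fin 3) := R⁻¹ • (x - x₀) with hy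
  have hxy : x₀ + R • y = x := by
    rw [hy, smul_smul, mul_inv_cancel₀ hR.ne', one_smul, add_sub_cancel]
  refine ⟨y, ⟨?_, ?_⟩, hxy⟩
  · rw [mem_ball, dist_zero_right, hy, norm_smul, norm_inv, Real.norm_of_nonneg hR.le]
    rw [mem_ball, dist_eq_norm] at hx
    calc R⁻¹ * ‖x - x₀‖ < R⁻¹ * R := mul_lt_mul_of_pos_left hx (inv_pos.2 hR)
      _ = 1 := inv_mul_cancel₀ hR.ne'
  · intro r hr
    by_contra hne
    have hlt : eLpNorm (uncurry (α • stPull β R T x₀ u)) ∞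
        (volume.restrict (parabolicCylinder (min r 1) (((0 : ℝ), y) : ℝ × EuclideanSpace ℝ (Fin 3)))) < ⊤ := by
      refine lt_of_le_of_lt (eLpNorm_mono_measure _ (Measure.restrict_mono ?_ le_rfl))
        (lt_top_iff_ne_top.2 hne)
      exact parabolicCylinder_mono (le_min hr.le zero_le_one) (min_le_left _ _) _
    obtain ⟨r', hr', A, hA⟩ := bounded_of_zoom_bounded hT hα hβ hR hcont (lt_min hr one_pos) hlt
    rw [hxy] at hA
    exact hscar ⟨r', hr', A, hA⟩

/-- **NEAR-MISS OF RECORD for `FiniteScarsTypeI` (23842): the scar set of a sup-norm Type-I blow-up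
is `H¹`-null.**  For a classical solution on `[0, T)` with viscosity `ν > 0`, Leray–Hopf on `[0, T)`,
with the Type-I rate `IsTypeIBlowup u T`: the set of points `x` at which `u` is NOT bounded on any
backward parabolic neighbourhood `[T − r², T) × B(x, r)` has one-dimensional Hausdorff measure zero.
(Item 23842 asks for this set to be FINITE — open.) -/
theorem hausdorffMeasure_scarSet_eq_zero_of_typeI {ν T : ℝ} (hν : 0 < ν) (hT : 0 < T)
    {u : ℝ → EuclideanSpace ℝ (Fin 3) → EuclideanSpace ℝ (Fin 3)}
    {p : ℝ → EuclideanSpace ℝ (Fin 3) → ℝ}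
    (hsol : IsClassicalNSSolutionOn (Ico 0 T) ν 0 u p) (hLH : IsLerayHopfOn T ν 0 (u 0) u)
    (hTI : IsTypeIBlowup u T) :
    μH[1] {x : EuclideanSpace ℝ (Fin 3) | ¬ ∃ r : ℝ, 0 < r ∧ ∃ A : ℝ,
        ∀ t ∈ Ico (T - r ^ 2) T, ∀ y ∈ ball x r, ‖u t y‖ ≤ A} = 0 := by
  set S : Set (EuclideanSpace ℝ (Fin 3)) := {x | ¬ ∃ r : ℝ, 0 < r ∧ ∃ A : ℝ,
    ∀ t ∈ Ico (T - r ^ 2) T, ∀ y ∈ ball x r, ‖u t y‖ ≤ A} with hS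
  have hcont : ContinuousOn (uncurry u) (Ico 0 T ×ˢ univ) := hsol.smooth_velocity.continuousOn
  -- ### the Morrey bound and, about every centre, the zoom in Albritton–Barker's class
  obtain ⟨r₀, M₀, T₁, hr₀, hT₁, hMor⟩ :=
    Summit.NavierStokesRegularity.NavierStokesRegularity.Theorems.morrey_of_typeI hν hT hsol hLH hTI
  have hloc : ∀ x₀ : EuclideanSpace ℝ (Fin 3), ∃ R : ℝ, 0 < R ∧ μH[1] (S ∩ ball x₀ R) = 0 := by
    intro x₀
    obtain ⟨R, α, β, hR, hα, hβ, -, -, -, hball, -, -⟩ :=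
      Summit.NavierStokesRegularity.NavierStokesRegularity.Theorems.exists_zoom_typeIBound_lt_top_of_morrey
        hν hT hsol hLH hr₀ hT₁ hMor x₀
    refine ⟨R, hR, ?_⟩
    -- Tsai at the top of `Q(0, 1)` for the zoom
    have hnull := Summit.NavierStokesRegularity.NavierStokesRegularity.Theorems.TypeITraceScarL3.hausdorffMeasure_topSingular_inBall_eq_zero
      (T := (0 : ℝ)) (x₀ := (0 : EuclideanSpace ℝ (Fin 3))) one_pos hball
    -- scars are Lipschitz images of top singular points
    have hsub : S ∩ ball x₀ R ⊆ (fun y : EuclideanSpace ℝ (Fin 3) => x₀ + R • y) ''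
        {y ∈ ball (0 : EuclideanSpace ℝ (Fin 3)) 1 |
          IsBackwardSingularPoint (α • stPull β R T x₀ u) ((0 : ℝ), y)} := by
      intro x hx
      exact scar_subset_image_topSingular hT hα hβ hR hcont ⟨hx.2, hx.1⟩
    have hLip : LipschitzWith (Real.toNNReal R) (fun y : EuclideanSpace ℝ (Fin 3) => x₀ + R • y) := by
      refine LipschitzWith.of_dist_le_mul fun y y' => ?_
      rw [dist_eq_norm, dist_eq_norm, add_sub_add_left_eq_sub, ← smul_sub, norm_smul,
        Real.norm_of_nonneg hR.le, Real.coe_toNNReal _ hR.le]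
    have himg := (hLip.lipschitzOnWith (s := {y ∈ ball (0 : EuclideanSpace ℝ (Fin 3)) 1 |
        IsBackwardSingularPoint (α • stPull β R T x₀ u) ((0 : ℝ), y)})).hausdorffMeasure_image_le
        (d := 1) zero_le_one
    rw [hnull, mul_zero] at himg
    exact measure_mono_null hsub (le_antisymm himg bot_le)
  -- ### a countable subcover
  choose Rof hRof hnullof using hloc
  obtain ⟨Tc, hTc, hcover⟩ := TopologicalSpace.isOpen_iUnion_countable
    (fun x : EuclideanSpace ℝ (Fin 3) => ball x (Rof x)) fun x => isOpen_ball
  have hSsub : S ⊆ ⋃ x ∈ Tc, ball x (Rof x) := by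
    rw [hcover]
    intro x hx
    exact mem_iUnion.2 ⟨x, mem_ball_self (hRof x)⟩
  have hSeq : S = ⋃ x ∈ Tc, S ∩ ball x (Rof x) := by
    apply Subset.antisymm
    · intro x hx
      obtain ⟨x', hx', hmem⟩ := mem_iUnion₂.1 (hSsub hx)
      exact mem_iUnion₂.2 ⟨x', hx', hx, hmem⟩
    · exact iUnion₂_subset fun x _ => inter_subset_left
  rw [hSeq]
  exact (measure_biUnion_null_iff hTc).2 fun x _ => hnullof x

/-- **The same, in item 23842's hypotheses** (maximal smooth solution, Leray–Hopf, rapidly decaying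
datum — unused —, Type-I rate): the scar set is `H¹`-null.  `FiniteScarsTypeI` asks for it to be
finite; this is the near-miss of record in the item's currency. -/
theorem hausdorffMeasure_scarSet_eq_zero {ν T : ℝ} (hν : 0 < ν) (hT : 0 < T)
    {u : ℝ → EuclideanSpace ℝ (Fin 3) → EuclideanSpace ℝ (Fin 3)}
    {p : ℝ → EuclideanSpace ℝ (Fin 3) → ℝ}
    (hmax : IsMaximalSmoothSolution ν 0 u p T) (hLH : IsLerayHopfOn T ν 0 (u 0) u)
    (_hdec : HasRapidSpatialDecay (u 0)) (hTI : IsTypeIBlowup u T) :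
    μH[1] {x : EuclideanSpace ℝ (Fin 3) | ¬ ∃ r : ℝ, 0 < r ∧ ∃ A : ℝ,
        ∀ t ∈ Ico (T - r ^ 2) T, ∀ y ∈ ball x r, ‖u t y‖ ≤ A} = 0 :=
  hausdorffMeasure_scarSet_eq_zero_of_typeI hν hT hmax.1 hLH hTI

end Summit.NavierStokesRegularity.NavierStokesRegularity.Theorems.FiniteScarsTypeI

end
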